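import Mathlib
import Summits.NavierStokesRegularity.NavierStokesRegularity.Theorems.LerayQuarterDissipationFiniteDissipationLiouvilleTrappingTools
import Summits.NavierStokesRegularity.NavierStokesRegularity.Theorems.LerayQuarterDissipationFiniteDissipationLiouvilleVorticityAmplitudeTools
import Summits.NavierStokesRegularity.NavierStokesRegularity.Theorems.LerayQuarterDissipationRecurrentReductionDScaling
import HarnessLib

/-!
# Crux `FiniteDissipationLiouville` (stmt-NavierStokesRegularity-22144): FORWARD TRAPPING of the
# similarity enstrophy below the explicit dissipation threshold (file 2/2: the theorem)

Theorems file of route `LerayQuarterDissipation` (lead prover g17; `--supports` the crux; sequel of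
`…TrappingTools`). Navier–Stokes regularity is NOT proved by anything here; no summit is.

`𝒟_{C,K}`: Type-I ancient mild fields `V` in the KNSS gauge with Leray's quarter-rate law
`∫‖DV(t)‖² ≤ K/√(−t)`; `Z(s) = ∫‖Ω(s)‖²`, `Ω(s) = lerayVorticity V s`, the global similarity
enstrophy (`= √(−t)∫‖curl V(t)‖²dx`, `t = −e^{−s}`); `K_S` Mathlib's Gagliardo–Nirenberg–Sobolev
constant. A NEW MECHANISM for the line — FORWARD INVARIANCE: the Ladyzhenskaya-priced enstrophy
budget is self-improving (`Z' ≤ −½Z + (27/128)K_S⁶Z³` formally), so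

* **`trapping_exp`** / **`trapping`** — **if `(√Z(s₀)·(√K_S)³)⁴ < 64/27` at ONE instant `s₀` (the
  number of the explicit all-time rung `θ(K)⁴ < 64/27` of `…SmallDissipationGapSharper`), then
  `Z(s) ≤ e^{−κ(s−s₀)}Z(s₀) ≤ Z(s₀)` for all `s ≥ s₀`** (some `κ > 0`): a bootstrap on windows —
  below a fixed level `k > Z(s₀)` the SLICE-WISE budget (`…TrappingTools.deriv_sqCutoffEnstrophy_le_slice`)
  is damped, a crude Grönwall step extends the window by a fixed length, `R → ∞` at each step;
* `integral_sq_norm_lerayVorticity_eq` (`Z(s) = √(−t)∫‖curl V(t)‖²`), `lintegral_fderiv_sq_le_of_lerayOrbit`,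
  `law_from_of_trapping` — physical reading: from that instant on the law holds with the SMALLER
  constant `Z(s₀)`: `∫⁻‖DV(t)‖ₑ² ≤ Z(s₀)/√(−t)` for `−e^{−s₀} ≤ t < 0`.

The companion `…EveryInstant` turns this into an explicit EVERY-INSTANT floor for singular members.

HONEST FRAMING. Statements about a HYPOTHETICAL object; the threshold is explicit in Mathlib's
non-sharp `K_S`, the rate `κ` existential. Nothing is removed from the catalogued DSS wall
(`∀ c > 1, TypeIDSSLiouville c`, NECESSARY for the crux); verdict of the line unchanged (FRONTIER).
Nothing here bears on Navier–Stokes regularity or blow-up.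

References: J. Leray, Acta Math. 63 (1934) §20; Koch–Nadirashvili–Seregin–Šverák, Acta Math. 203
(2009) §4; folklore energy method.
-/

noncomputable section

set_option linter.dupNamespace false

namespace Summit.NavierStokesRegularity.NavierStokesRegularity.Theorems.FiniteDissipationLiouville.Trapping

open MeasureTheory Set Filter Topology Metric InnerProductSpace Function Real
open scoped RealInnerProductSpace ContDiff ENNReal Laplacian
open Literature.Analysis Literature.Analysis.FluidPDE
open Summit.NavierStokesRegularity.NavierStokesRegularity.Theorems
open Summit.NavierStokesRegularity.NavierStokesRegularity.Theorems.GaussianGap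
open Summit.NavierStokesRegularity.NavierStokesRegularity.Theorems.SimilarityEnstrophy
open Summit.NavierStokesRegularity.NavierStokesRegularity.Theorems.SmallDissipationGap

variable {C : ℝ} {V : ℝ → (EuclideanSpace ℝ (Fin 3)) → (EuclideanSpace ℝ (Fin 3))}

section Trapping

/-- **FORWARD TRAPPING with exponential decay.** Let `V ∈ 𝒟_{C,K}` and suppose that at ONE instant
`s₀` the global similarity enstrophy `Z(s₀) = ∫‖Ω(s₀)‖²` is below the explicit threshold,
`(√Z(s₀)·(√K_S)³)⁴ < 64/27` (i.e. `K_S⁶Z(s₀)² < 64/27`). Then for some `κ > 0`,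
`Z(s) ≤ e^{−κ(s−s₀)} Z(s₀)` for all `s ≥ s₀`. Proof: bootstrap on windows `[s₀, s₁]` on which
`Z ≤ k` for a fixed level `Z(s₀) < k` below the threshold: there the slice-wise budget priced at the
level `k` is damped (`Z_R' ≤ −κZ_R + LM/R`), so `Z ≤ e^{−κ(·−s₀)}Z(s₀) ≤ Z(s₀)` after `R → ∞`;
a crude Grönwall step from `Z(s₁) ≤ Z(s₀)` (budget priced by the law's own constant) keeps `Z ≤ k`
on `[s₁, s₁+τ]` for a fixed `τ > 0`; induction on the number of steps. [folklore energy method] -/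
theorem trapping_exp (hV : IsTypeIAncientMild C V) {K : ℝ}
    (hK : ∀ t : ℝ, t < 0 → ∫⁻ x, ‖fderiv ℝ (V t) x‖ₑ ^ 2 ≤ ENNReal.ofReal (K / Real.sqrt (-t)))
    {s₀ : ℝ}
    (h0 : (Real.sqrt (∫ y, ‖lerayVorticity V s₀ y‖ ^ 2) * Real.sqrt (SNormLESNormFDerivOfEqConst (EuclideanSpace ℝ (Fin 3))
        (volume : Measure (EuclideanSpace ℝ (Fin 3))) 2 : ℝ) ^ 3) ^ 4 < 64 / 27) :
    ∃ κ : ℝ, 0 < κ ∧ ∀ s : ℝ, s₀ ≤ s →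
      ∫ y, ‖lerayVorticity V s y‖ ^ 2 ≤
        Real.exp (-κ * (s - s₀)) * ∫ y, ‖lerayVorticity V s₀ y‖ ^ 2 := by
  have hC : 0 ≤ C := hV.nonneg
  have hKS0 : 0 ≤ (SNormLESNormFDerivOfEqConst (EuclideanSpace ℝ (Fin 3))
        (volume : Measure (EuclideanSpace ℝ (Fin 3))) 2 : ℝ) := NNReal.coe_nonneg _
  -- the global enstrophy `Z∞`, its bound `M`, and the law's quantity below it
  have hΩi := fun σ => integrable_sq_norm_lerayVorticity hV hK σ
  have hDU := fun σ => integrable_sq_norm_fderiv_lerayOrbit hV hK σ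
  have hDUle : ∀ σ, ∫ y, ‖fderiv ℝ (lerayOrbit V σ) y‖ ^ 2 ≤ ∫ y, ‖lerayVorticity V σ y‖ ^ 2 :=
    fun σ => VorticityAmplitude.integral_sq_norm_fderiv_lerayOrbit_le hV hK σ
  obtain ⟨M, hM0, hZiM⟩ : ∃ M : ℝ, 0 ≤ M ∧ ∀ σ, ∫ y, ‖lerayVorticity V σ y‖ ^ 2 ≤ M :=
    ⟨‖curlCLM‖ ^ 2 * max K 0, by positivity, fun σ => (hΩi σ).2⟩
  have hZi0 : ∀ σ, 0 ≤ ∫ y, ‖lerayVorticity V σ y‖ ^ 2 := fun σ => integral_nonneg fun y => sq_nonneg _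
  obtain ⟨z₀, hz₀def⟩ : ∃ z₀ : ℝ, z₀ = ∫ y, ‖lerayVorticity V s₀ y‖ ^ 2 := ⟨_, rfl⟩
  rw [← hz₀def] at h0 ⊢
  have hz0 : 0 ≤ z₀ := hz₀def ▸ hZi0 s₀
  -- the cutoff enstrophies lie below `Z∞`
  have hZRle : ∀ (R : ℝ) (σ : ℝ), (∫ y, smoothTransition (2 - ‖y‖ ^ 2 / R ^ 2) ^ 2 *
      ‖lerayVorticity V σ y‖ ^ 2) ≤ ∫ y, ‖lerayVorticity V σ y‖ ^ 2 := by
    intro R σ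
    refine integral_mono_of_nonneg (Eventually.of_forall fun y =>
      mul_nonneg (sq_nonneg _) (sq_nonneg _)) (hΩi σ).1 (Eventually.of_forall fun y => ?_)
    exact mul_le_of_le_one_left (sq_nonneg _) (sqCutoff_le_one R y)
  have hZR0 : ∀ (R : ℝ) (σ : ℝ), 0 ≤ ∫ y, smoothTransition (2 - ‖y‖ ^ 2 / R ^ 2) ^ 2 *
      ‖lerayVorticity V σ y‖ ^ 2 := fun R σ =>
    integral_nonneg fun y => mul_nonneg (sq_nonneg _) (sq_nonneg _)
  have hIle : ∀ (R : ℝ) (σ : ℝ), (∫ y in closedBall (0 : EuclideanSpace ℝ (Fin 3)) (2 * R),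
      ‖lerayVorticity V σ y‖ ^ 2) ≤ M := fun R σ =>
    (setIntegral_le_integral (hΩi σ).1 (Eventually.of_forall fun y => sq_nonneg _)).trans (hZiM σ)
  -- `θ(k)⁴ = k²K_S⁶`
  have hθ4 : ∀ k : ℝ, 0 ≤ k → (Real.sqrt k * Real.sqrt (SNormLESNormFDerivOfEqConst (EuclideanSpace ℝ (Fin 3))
        (volume : Measure (EuclideanSpace ℝ (Fin 3))) 2 : ℝ) ^ 3) ^ 4 = k ^ 2 * (SNormLESNormFDerivOfEqConst (EuclideanSpace ℝ (Fin 3))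
        (volume : Measure (EuclideanSpace ℝ (Fin 3))) 2 : ℝ) ^ 6 := by
    intro k hk
    rw [mul_pow, show Real.sqrt k ^ 4 = (Real.sqrt k ^ 2) ^ 2 by ring, Real.sq_sqrt hk,
      show (Real.sqrt (SNormLESNormFDerivOfEqConst (EuclideanSpace ℝ (Fin 3))
        (volume : Measure (EuclideanSpace ℝ (Fin 3))) 2 : ℝ) ^ 3) ^ 4 = (Real.sqrt (SNormLESNormFDerivOfEqConst (EuclideanSpace ℝ (Fin 3))
        (volume : Measure (EuclideanSpace ℝ (Fin 3))) 2 : ℝ) ^ 2) ^ 6 by ring, Real.sq_sqrt hKS0]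
  -- (1) a level `k > z₀` still below the threshold
  obtain ⟨k, hzk, hk⟩ : ∃ k : ℝ, z₀ < k ∧ k ^ 2 * (SNormLESNormFDerivOfEqConst (EuclideanSpace ℝ (Fin 3))
        (volume : Measure (EuclideanSpace ℝ (Fin 3))) 2 : ℝ) ^ 6 < 64 / 27 := by
    have h0' : z₀ ^ 2 * (SNormLESNormFDerivOfEqConst (EuclideanSpace ℝ (Fin 3))
        (volume : Measure (EuclideanSpace ℝ (Fin 3))) 2 : ℝ) ^ 6 < 64 / 27 := by rw [← hθ4 z₀ hz0]; exact h0
    have hcont : ContinuousAt (fun k : ℝ => k ^ 2 * (SNormLESNormFDerivOfEqConst (EuclideanSpace ℝ (Fin 3))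
        (volume : Measure (EuclideanSpace ℝ (Fin 3))) 2 : ℝ) ^ 6) z₀ := by fun_prop
    have hev : ∀ᶠ k in 𝓝[>] z₀, k ^ 2 * (SNormLESNormFDerivOfEqConst (EuclideanSpace ℝ (Fin 3))
        (volume : Measure (EuclideanSpace ℝ (Fin 3))) 2 : ℝ) ^ 6 < 64 / 27 :=
      nhdsWithin_le_nhds (hcont.eventually_lt continuousAt_const h0')
    obtain ⟨k, hk1, hk2⟩ := (hev.and self_mem_nhdsWithin).exists
    exact ⟨k, hk2, hk1⟩
  have hk0 : 0 < k := lt_of_le_of_lt hz0 hzk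
  -- (2) damped weights at the level `k`, crude weights at the law's own level
  obtain ⟨m, δ, κ, hmpos, hδpos, hκpos, hspend, hcoef⟩ :=
    exists_damped_weights hk0.le (by rw [hθ4 k hk0.le]; exact hk)
  obtain ⟨L, hL0, hL⟩ := deriv_sqCutoffEnstrophy_le_slice hV (KU := k) hmpos hδpos hspend
  obtain ⟨m₂, a, hm₂pos, hapos, hspend₂, hcoef₂⟩ := exists_crude_weights (max K 0)
  obtain ⟨L₂, hL₂0, hL₂⟩ := deriv_sqCutoffEnstrophy_le_slice hV (KU := max K 0) hm₂pos one_pos hspend₂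
  -- differentiability of the cutoff enstrophies
  have hdiff : ∀ R : ℝ, 0 < R → Differentiable ℝ fun σ =>
      ∫ y, smoothTransition (2 - ‖y‖ ^ 2 / R ^ 2) ^ 2 * ‖lerayVorticity V σ y‖ ^ 2 :=
    fun R hR σ => (hasDerivAt_sqCutoffEnstrophy hV hR σ).differentiableAt
  -- STEP B: below the level `k` on a window, the enstrophy decays from `z₀`
  have stepB : ∀ s₁ : ℝ, (∀ σ ∈ Icc s₀ s₁, ∫ y, ‖lerayVorticity V σ y‖ ^ 2 ≤ k) →
      ∀ σ ∈ Icc s₀ s₁, ∫ y, ‖lerayVorticity V σ y‖ ^ 2 ≤ Real.exp (-κ * (σ - s₀)) * z₀ := by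
    intro s₁ hwin σ hσ
    refine integral_sq_norm_lerayVorticity_le_of_forall_nat hV hK σ (B := L * M / κ) fun n hn => ?_
    have hR : 0 < (n : ℝ) := lt_of_lt_of_le one_pos hn
    have hode : ∀ σ' ∈ Icc s₀ s₁, deriv (fun σ =>
        ∫ y, smoothTransition (2 - ‖y‖ ^ 2 / (n : ℝ) ^ 2) ^ 2 * ‖lerayVorticity V σ y‖ ^ 2) σ' ≤
        (-κ) * (∫ y, smoothTransition (2 - ‖y‖ ^ 2 / (n : ℝ) ^ 2) ^ 2 * ‖lerayVorticity V σ' y‖ ^ 2) +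
          L * M / n := by
      intro σ' hσ'
      have h := hL n hn σ' (hDU σ').1 ((hDUle σ').trans (hwin σ' hσ'))
      have h1 := mul_le_mul_of_nonneg_right hcoef (hZR0 n σ')
      have h2 : L / n * (∫ y in closedBall (0 : EuclideanSpace ℝ (Fin 3)) (2 * n),
          ‖lerayVorticity V σ' y‖ ^ 2) ≤ L * M / n := by
        have := mul_le_mul_of_nonneg_left (hIle n σ') (div_nonneg hL0 hR.le)
        calc _ ≤ L / n * M := this
          _ = L * M / n := by ring
      linarith
    have hcmp := le_of_deriv_le_mul_add_Icc (hdiff n hR) (neg_ne_zero.2 hκpos.ne') hode σ hσ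
    have hexp0 : 0 < Real.exp (-κ * (σ - s₀)) := Real.exp_pos _
    have hexp1 : Real.exp (-κ * (σ - s₀)) ≤ 1 := by
      rw [Real.exp_le_one_iff, neg_mul, neg_nonpos]
      exact mul_nonneg hκpos.le (by linarith [hσ.1])
    have e : Real.exp (-κ * (σ - s₀)) *
        ((∫ y, smoothTransition (2 - ‖y‖ ^ 2 / (n : ℝ) ^ 2) ^ 2 * ‖lerayVorticity V s₀ y‖ ^ 2) +
          L * M / ↑n / -κ) - L * M / ↑n / -κ =
        Real.exp (-κ * (σ - s₀)) *
          (∫ y, smoothTransition (2 - ‖y‖ ^ 2 / (n : ℝ) ^ 2) ^ 2 * ‖lerayVorticity V s₀ y‖ ^ 2) +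
          (1 - Real.exp (-κ * (σ - s₀))) * (L * M / κ / n) := by
      field_simp
      ring
    rw [e] at hcmp
    have h4 : 0 ≤ L * M / κ / n := by positivity
    have h3 : (1 - Real.exp (-κ * (σ - s₀))) * (L * M / κ / n) ≤ L * M / κ / n := by
      nlinarith only [h4, hexp0]
    have h5 : Real.exp (-κ * (σ - s₀)) *
        (∫ y, smoothTransition (2 - ‖y‖ ^ 2 / (n : ℝ) ^ 2) ^ 2 * ‖lerayVorticity V s₀ y‖ ^ 2) ≤
        Real.exp (-κ * (σ - s₀)) * z₀ :=
      mul_le_mul_of_nonneg_left (hz₀def ▸ hZRle n s₀) hexp0.le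
    linarith
  -- STEP C: a crude step of fixed length `τ` from any instant where `Z∞ ≤ z₀`
  obtain ⟨τ, hτpos, hτ⟩ : ∃ τ : ℝ, 0 < τ ∧ Real.exp (a * τ) * z₀ < k := by
    have hcont : ContinuousAt (fun τ : ℝ => Real.exp (a * τ) * z₀) 0 := by fun_prop
    have h00 : Real.exp (a * 0) * z₀ < k := by rw [mul_zero, Real.exp_zero, one_mul]; exact hzk
    have hev : ∀ᶠ τ in 𝓝[>] (0 : ℝ), Real.exp (a * τ) * z₀ < k :=
      nhdsWithin_le_nhds (hcont.eventually_lt continuousAt_const h00)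
    obtain ⟨τ, hτ1, hτ2⟩ := (hev.and self_mem_nhdsWithin).exists
    exact ⟨τ, hτ2, hτ1⟩
  have stepC : ∀ s₁ : ℝ, (∫ y, ‖lerayVorticity V s₁ y‖ ^ 2) ≤ z₀ →
      ∀ σ ∈ Icc s₁ (s₁ + τ), ∫ y, ‖lerayVorticity V σ y‖ ^ 2 ≤ k := by
    intro s₁ hs₁ σ hσ
    have hστ : σ - s₁ ≤ τ := by linarith [hσ.2]
    refine (integral_sq_norm_lerayVorticity_le_of_forall_nat hV hK σ
      (A := Real.exp (a * τ) * z₀) (B := Real.exp (a * τ) * (L₂ * M / a)) fun n hn => ?_).trans hτ.le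
    have hR : 0 < (n : ℝ) := lt_of_lt_of_le one_pos hn
    have hode : ∀ σ' ∈ Icc s₁ (s₁ + τ), deriv (fun σ =>
        ∫ y, smoothTransition (2 - ‖y‖ ^ 2 / (n : ℝ) ^ 2) ^ 2 * ‖lerayVorticity V σ y‖ ^ 2) σ' ≤
        a * (∫ y, smoothTransition (2 - ‖y‖ ^ 2 / (n : ℝ) ^ 2) ^ 2 * ‖lerayVorticity V σ' y‖ ^ 2) +
          L₂ * M / n := by
      intro σ' _
      have h := hL₂ n hn σ' (hDU σ').1 (hDU σ').2
      have h1 := mul_le_mul_of_nonneg_right hcoef₂ (hZR0 n σ')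
      have h2 : L₂ / n * (∫ y in closedBall (0 : EuclideanSpace ℝ (Fin 3)) (2 * n),
          ‖lerayVorticity V σ' y‖ ^ 2) ≤ L₂ * M / n := by
        have := mul_le_mul_of_nonneg_left (hIle n σ') (div_nonneg hL₂0 hR.le)
        calc _ ≤ L₂ / n * M := this
          _ = L₂ * M / n := by ring
      linarith
    have hcmp := le_of_deriv_le_mul_add_Icc (hdiff n hR) hapos.ne' hode σ hσ
    have hb : 0 ≤ L₂ * M / n / a := by positivity
    have hexpτ : Real.exp (a * (σ - s₁)) ≤ Real.exp (a * τ) :=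
      Real.exp_le_exp.2 (mul_le_mul_of_nonneg_left hστ hapos.le)
    have hsum0 : 0 ≤ (∫ y, smoothTransition (2 - ‖y‖ ^ 2 / (n : ℝ) ^ 2) ^ 2 *
        ‖lerayVorticity V s₁ y‖ ^ 2) + L₂ * M / n / a := add_nonneg (hZR0 n s₁) hb
    have hZs : (∫ y, smoothTransition (2 - ‖y‖ ^ 2 / (n : ℝ) ^ 2) ^ 2 * ‖lerayVorticity V s₁ y‖ ^ 2) +
        L₂ * M / n / a ≤ z₀ + L₂ * M / n / a := by linarith [(hZRle n s₁).trans hs₁]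
    have h3 : Real.exp (a * (σ - s₁)) *
        ((∫ y, smoothTransition (2 - ‖y‖ ^ 2 / (n : ℝ) ^ 2) ^ 2 * ‖lerayVorticity V s₁ y‖ ^ 2) +
          L₂ * M / n / a) ≤ Real.exp (a * τ) * (z₀ + L₂ * M / n / a) :=
      (mul_le_mul_of_nonneg_right hexpτ hsum0).trans (mul_le_mul_of_nonneg_left hZs
        (Real.exp_pos _).le)
    have e : Real.exp (a * τ) * (z₀ + L₂ * M / n / a) =
        Real.exp (a * τ) * z₀ + Real.exp (a * τ) * (L₂ * M / a) / n := by
      field_simp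
    linarith [hcmp, h3, e.le]
  -- INDUCTION on the number of steps
  have hind : ∀ n : ℕ, ∀ σ ∈ Icc s₀ (s₀ + n * τ), ∫ y, ‖lerayVorticity V σ y‖ ^ 2 ≤ k := by
    intro n
    induction n with
    | zero =>
        intro σ hσ
        simp only [Nat.cast_zero, zero_mul, add_zero] at hσ
        have : σ = s₀ := le_antisymm hσ.2 hσ.1
        rw [this, ← hz₀def]; exact hzk.le
    | succ n ih =>
        intro σ hσ
        rcases le_or_gt σ (s₀ + n * τ) with h | h
        · exact ih σ ⟨hσ.1, h⟩
        · have hnτ : 0 ≤ (n : ℝ) * τ := mul_nonneg n.cast_nonneg hτpos.le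
          have hB := stepB (s₀ + n * τ) ih (s₀ + n * τ) ⟨by linarith, le_rfl⟩
          have hexp1 : Real.exp (-κ * (s₀ + n * τ - s₀)) ≤ 1 := by
            rw [Real.exp_le_one_iff, neg_mul, neg_nonpos]
            exact mul_nonneg hκpos.le (by linarith)
          have hz₁ : (∫ y, ‖lerayVorticity V (s₀ + n * τ) y‖ ^ 2) ≤ z₀ :=
            hB.trans (mul_le_of_le_one_left hz0 hexp1)
          refine stepC (s₀ + n * τ) hz₁ σ ⟨h.le, ?_⟩
          have := hσ.2; push_cast at this; linarith
  -- CONCLUSION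
  refine ⟨κ, hκpos, fun s hs => ?_⟩
  obtain ⟨n, hn⟩ : ∃ n : ℕ, s ≤ s₀ + n * τ := by
    obtain ⟨n, hn⟩ := exists_nat_ge ((s - s₀) / τ)
    refine ⟨n, ?_⟩
    have := (div_le_iff₀ hτpos).1 hn
    linarith
  exact stepB s (fun σ hσ => hind n σ ⟨hσ.1, hσ.2.trans hn⟩) s ⟨hs, le_rfl⟩

/-- **FORWARD TRAPPING.** If `V ∈ 𝒟_{C,K}` has `(√Z(s₀)·(√K_S)³)⁴ < 64/27` at one instant `s₀`
(`Z(s) = ∫‖Ω(s)‖²` the global similarity enstrophy), then `Z(s) ≤ Z(s₀)` for every `s ≥ s₀`: the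
sub-threshold region of the explicit small-dissipation rung is forward invariant along every member
of the stratum. [folklore energy method] -/
theorem trapping (hV : IsTypeIAncientMild C V) {K : ℝ}
    (hK : ∀ t : ℝ, t < 0 → ∫⁻ x, ‖fderiv ℝ (V t) x‖ₑ ^ 2 ≤ ENNReal.ofReal (K / Real.sqrt (-t)))
    {s₀ : ℝ}
    (h0 : (Real.sqrt (∫ y, ‖lerayVorticity V s₀ y‖ ^ 2) * Real.sqrt (SNormLESNormFDerivOfEqConst (EuclideanSpace ℝ (Fin 3))
        (volume : Measure (EuclideanSpace ℝ (Fin 3))) 2 : ℝ) ^ 3) ^ 4 < 64 / 27) :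
    ∀ s : ℝ, s₀ ≤ s → ∫ y, ‖lerayVorticity V s y‖ ^ 2 ≤ ∫ y, ‖lerayVorticity V s₀ y‖ ^ 2 := by
  obtain ⟨κ, hκ, h⟩ := trapping_exp hV hK h0
  intro s hs
  refine (h s hs).trans (mul_le_of_le_one_left (integral_nonneg fun y => sq_nonneg _) ?_)
  rw [Real.exp_le_one_iff, neg_mul, neg_nonpos]
  exact mul_nonneg hκ.le (by linarith)

end Trapping

/-! ### Physical reading -/

section Physical

/-- **The similarity enstrophy in physical variables.** For `t = −e^{−s}`:
`∫‖Ω(s)‖² = √(−t)·∫‖curl V(t)‖²dx` whenever the physical vorticity slice is square integrable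
(`Ω(s)(y) = e^{−s}·curl V(t)(e^{−s/2}y)`, substitution `x = e^{−s/2}y`). [folklore; Leray 1934 §20] -/
theorem integral_sq_norm_lerayVorticity_eq (V : ℝ → EuclideanSpace ℝ (Fin 3) → EuclideanSpace ℝ (Fin 3))
    (s : ℝ) :
    ∫ y, ‖lerayVorticity V s y‖ ^ 2 =
      Real.exp (-s / 2) * ∫ x, ‖curl (V (-Real.exp (-s))) x‖ ^ 2 := by
  set c : ℝ := Real.exp (-s / 2) with hcdef
  have hc : 0 < c := Real.exp_pos _
  have hrepr : ∀ y, ‖lerayVorticity V s y‖ ^ 2 =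
      Real.exp (-s) ^ 2 * (fun x => ‖curl (V (-Real.exp (-s))) x‖ ^ 2) (c • y) := by
    intro y
    rw [lerayVorticity_apply, curl_lerayOrbit, norm_smul, Real.norm_of_nonneg (Real.exp_pos _).le,
      mul_pow]
  have hfun : (fun y => ‖lerayVorticity V s y‖ ^ 2) =
      fun y => Real.exp (-s) ^ 2 * (fun x => ‖curl (V (-Real.exp (-s))) x‖ ^ 2) (c • y) :=
    funext hrepr
  have hsc : (∫ y, (fun x => ‖curl (V (-Real.exp (-s))) x‖ ^ 2) (c • y)) =
      |(c ^ 3)⁻¹| • ∫ x, ‖curl (V (-Real.exp (-s))) x‖ ^ 2 := by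
    have h := Measure.integral_comp_smul (volume : Measure (EuclideanSpace ℝ (Fin 3)))
      (fun x => ‖curl (V (-Real.exp (-s))) x‖ ^ 2) c
    rw [finrank_euclideanSpace_fin] at h
    exact h
  rw [hfun, integral_const_mul, hsc, smul_eq_mul, abs_of_nonneg (by positivity), ← mul_assoc]
  congr 1
  have e2 : Real.exp (-s) = c * c := by rw [hcdef, ← Real.exp_add]; congr 1; ring
  rw [e2]; field_simp

/-- **From a similarity slice bound to the physical law at that instant.** If
`∫‖DU(s)‖² ≤ z` (`U(s) = lerayOrbit V s`, square-integrable gradient), then at `t = −e^{−s}`: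
`∫⁻‖DV(t)‖ₑ² ≤ z/√(−t)` (`U(s)` is the `−1` slice of the rescaling `V_{e^{−s/2}}`, and
`∫⁻‖∇V_c(−1)‖ₑ² = c∫⁻‖∇V(−c²)‖ₑ²`). [folklore; Leray 1934 §20] -/
theorem lintegral_fderiv_sq_le_of_lerayOrbit (V : ℝ → EuclideanSpace ℝ (Fin 3) → EuclideanSpace ℝ (Fin 3))
    {s z : ℝ} (hint : Integrable (fun y => ‖fderiv ℝ (lerayOrbit V s) y‖ ^ 2))
    (hle : ∫ y, ‖fderiv ℝ (lerayOrbit V s) y‖ ^ 2 ≤ z) :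
    ∫⁻ x, ‖fderiv ℝ (V (-Real.exp (-s))) x‖ₑ ^ 2 ≤
      ENNReal.ofReal (z / Real.sqrt (-(-Real.exp (-s)))) := by
  set c : ℝ := Real.exp (-s / 2) with hcdef
  have hc : 0 < c := Real.exp_pos _
  have hc2 : c ^ 2 * (-1) = -Real.exp (-s) := by
    rw [hcdef, sq, ← Real.exp_add]; ring_nf
  have hz : 0 ≤ z := le_trans (integral_nonneg fun y => sq_nonneg _) hle
  -- `∫⁻ ‖DU(s)‖ₑ² = ofReal c * ∫⁻ ‖DV(t)‖ₑ²`
  have h1 : ∫⁻ y, ‖fderiv ℝ (lerayOrbit V s) y‖ₑ ^ 2 =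
      ENNReal.ofReal c * ∫⁻ x, ‖fderiv ℝ (V (-Real.exp (-s))) x‖ₑ ^ 2 := by
    rw [VorticityAmplitude.lerayOrbit_eq_nsRescale_neg_one, ← hcdef,
      RecurrentReductionD.lintegral_fderiv_nsRescale_sq hc, hc2]
  -- `∫⁻ ‖DU(s)‖ₑ² ≤ ofReal z`
  have h2 : ∫⁻ y, ‖fderiv ℝ (lerayOrbit V s) y‖ₑ ^ 2 ≤ ENNReal.ofReal z := by
    rw [← ofReal_integral_sq_norm hint]
    exact ENNReal.ofReal_le_ofReal hle
  rw [h1] at h2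
  rw [neg_neg, sqrt_exp_neg, ← hcdef, ENNReal.ofReal_div_of_pos hc]
  rw [ENNReal.le_div_iff_mul_le (Or.inl ((ENNReal.ofReal_pos.2 hc).ne'))
    (Or.inl ENNReal.ofReal_ne_top), mul_comm]
  exact h2

/-- **Physical reading of the trapping: the law with the smaller constant from that instant on.**
If `V ∈ 𝒟_{C,K}` has `(√Z(s₀)·(√K_S)³)⁴ < 64/27` at the instant `s₀` (`t₀ = −e^{−s₀}`), then
`∫⁻‖DV(t)‖ₑ² ≤ Z(s₀)/√(−t)` for all `t₀ ≤ t < 0`. [folklore energy method] -/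
theorem law_from_of_trapping (hV : IsTypeIAncientMild C V) {K : ℝ}
    (hK : ∀ t : ℝ, t < 0 → ∫⁻ x, ‖fderiv ℝ (V t) x‖ₑ ^ 2 ≤ ENNReal.ofReal (K / Real.sqrt (-t)))
    {s₀ : ℝ}
    (h0 : (Real.sqrt (∫ y, ‖lerayVorticity V s₀ y‖ ^ 2) * Real.sqrt (SNormLESNormFDerivOfEqConst (EuclideanSpace ℝ (Fin 3))
        (volume : Measure (EuclideanSpace ℝ (Fin 3))) 2 : ℝ) ^ 3) ^ 4 < 64 / 27) :
    ∀ t : ℝ, -Real.exp (-s₀) ≤ t → t < 0 →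
      ∫⁻ x, ‖fderiv ℝ (V t) x‖ₑ ^ 2 ≤
        ENNReal.ofReal ((∫ y, ‖lerayVorticity V s₀ y‖ ^ 2) / Real.sqrt (-t)) := by
  intro t ht₀ ht
  set s : ℝ := -Real.log (-t) with hs
  have hts : -Real.exp (-s) = t := by rw [hs, neg_neg, Real.exp_log (neg_pos.2 ht), neg_neg]
  have hs₀ : s₀ ≤ s := by
    rw [hs, le_neg, ← Real.exp_le_exp, Real.exp_log (neg_pos.2 ht)]
    linarith
  have hZ := trapping hV hK h0 s hs₀
  have hDU := integrable_sq_norm_fderiv_lerayOrbit hV hK s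
  have hle := (VorticityAmplitude.integral_sq_norm_fderiv_lerayOrbit_le hV hK s).trans hZ
  have h := lintegral_fderiv_sq_le_of_lerayOrbit V hDU.1 hle
  rwa [hts] at h

end Physical

end Summit.NavierStokesRegularity.NavierStokesRegularity.Theorems.FiniteDissipationLiouville.Trapping

end
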